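import Mathlib
import Summits.NavierStokesRegularity.NavierStokesRegularity.Theses.TrappingWindowRungThree
import HarnessLib

/-!
# `TrappingWindowRungThree.TrappingBootstrap` (item stmt-NavierStokesRegularity-21749, support S1)

The load-bearing glue of route `TrappingWindowRungThree` (rung TL-M3 of the Tao-ladder, MODEL
lattice ODEs): the window certificate K1 (`WindowCertificate`, a trapping dichotomy for the
`(η, η)`-defect differential inclusion on a finite window of shells) and the analytic tail envelopes
K2 (`TailEnvelopes`) together give a `RobustStep` at scale ratio `2` (`ε₀ = 1`) from the description

  `P S₀ F₀ :=` «the window state lies in one of the certificate's boxes `B_j`» ∧ «the behind tail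
  amplitudes lie under `Cb · 2^{(3/4)|k|}`» ∧ «the ahead tail energies lie under `Cg · 2^{-7k}`»,

which contains the rescaled one-shell datum, with epoch envelope the piecewise envelope of K1/K2.

PROOF (first-exit / continuity argument, as planned in the route file). Fix a pseudo-flow from a
state in `P` on a horizon `τ ≥ c` and suppose no `StepTo` exists. Let
`s := {σ ∈ [0, c] : |S_{i,k}(σ)| ≤ M_k on the window}`; it is closed (finitely many continuous
coordinates) and contains `0` (boxes sit strictly inside the sup bounds). If `[0, t] ⊆ s` then K2
(applied with `σ = t`) delivers strictly admissible boundary shells and a strict phantom budget on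
`[0, t]`, so K1's dichotomy applies on `[0, t]`: its STEP branch would be a `StepTo` (the new state is
in `P` by K1's landing clauses and K2's tail reproduction, the epoch envelope holds by K2 and
`|S_k| ≤ M_k`), hence the INSIDE branch holds — `t < c` and the window bounds are strict at time `t`,
so by continuity `s` contains a right neighbourhood of `t`. Real induction
(`IsClosed.Icc_subset_of_forall_mem_nhdsGT_of_Icc_subset`) gives `[0, c] ⊆ s`, and the same
argument at `t = c` yields `c < c`.

HONEST FRAMING: bookkeeping about Tao-type MODEL lattice pseudo-flows in the cell vocabulary
(`PseudoFlowOn`, `RobustStep`, `StepTo`, `slackWeight`); nothing here is a statement about the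
Navier–Stokes equations, the route's leaf `TaoLadderRungThree.Target` (TL-M3) is not the summit
Statement, and NS regularity is NOT proved by anything in this file. The two cruxes K1, K2 are
hypotheses of the statement proved here, not discharged.
-/

noncomputable section

-- the sub-problem namespace repeats the summit name by design (D-0017)
set_option linter.dupNamespace false

namespace Summit.NavierStokesRegularity.NavierStokesRegularity.Theorems

open Set Filter Topology Literature.Analysis.FluidPDE Literature.Analysis.FluidPDE.TaoCascade

namespace TrappingBootstrap

/-- If `2^{-θ} ≤ a` then `1 ≤ 2^θ · a`. [folklore] -/
theorem one_le_two_rpow_mul {θ a : ℝ} (h : (2 : ℝ) ^ (-θ) ≤ a) : 1 ≤ (2 : ℝ) ^ θ * a := by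
  have h2 : (0 : ℝ) ≤ (2 : ℝ) ^ θ := Real.rpow_nonneg zero_le_two θ
  calc (1 : ℝ) = (2 : ℝ) ^ θ * (2 : ℝ) ^ (-θ) := by
        rw [← Real.rpow_add two_pos, add_neg_cancel, Real.rpow_zero]
    _ ≤ (2 : ℝ) ^ θ * a := mul_le_mul_of_nonneg_left h h2

/-- Division by a ratio `a ≥ 2^{-θ}` costs at most a factor `2^θ`: `x / a ≤ x · 2^θ` for `x ≥ 0`.
[folklore] -/
theorem div_le_mul_two_rpow {θ a x : ℝ} (ha : 0 < a) (h : (2 : ℝ) ^ (-θ) ≤ a) (hx : 0 ≤ x) :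
    x / a ≤ x * (2 : ℝ) ^ θ := by
  rw [div_le_iff₀ ha, mul_assoc]
  have := one_le_two_rpow_mul h
  nlinarith

/-- Division by the square of a ratio `a ≥ 2^{-θ}` costs at most `2^{2θ}`: `x / a² ≤ x · 2^{2θ}`
for `x ≥ 0`. [folklore] -/
theorem div_sq_le_mul_two_rpow {θ a x : ℝ} (ha : 0 < a) (h : (2 : ℝ) ^ (-θ) ≤ a) (hx : 0 ≤ x) :
    x / a ^ 2 ≤ x * (2 : ℝ) ^ (2 * θ) := by
  rw [div_le_iff₀ (pow_pos ha 2)]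
  have h1 := one_le_two_rpow_mul h
  have h2 : (2 : ℝ) ^ (2 * θ) = (2 : ℝ) ^ θ * (2 : ℝ) ^ θ := by
    rw [two_mul, Real.rpow_add two_pos]
  have h3 : 1 ≤ (2 : ℝ) ^ (2 * θ) * a ^ 2 := by
    rw [h2]
    have : (2 : ℝ) ^ θ * (2 : ℝ) ^ θ * a ^ 2 = ((2 : ℝ) ^ θ * a) * ((2 : ℝ) ^ θ * a) := by ring
    rw [this]
    exact one_le_mul_of_one_le_of_one_le h1 h1
  calc x = x * 1 := (mul_one x).symm
    _ ≤ x * ((2 : ℝ) ^ (2 * θ) * a ^ 2) := mul_le_mul_of_nonneg_left h3 hx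
    _ = x * (2 : ℝ) ^ (2 * θ) * a ^ 2 := by ring

/-- Behind-tail bookkeeping of the step: for `θ ≤ 1/2`,
`2^{1/4} · (Cb · 2^{(3/4)(-(1+k))}) · 2^θ ≤ Cb · 2^{(3/4)(-k)}` (`Cb ≥ 0`). [folklore] -/
theorem behind_shift_le {θ Cb : ℝ} (hθ : θ ≤ 1 / 2) (hCb : 0 ≤ Cb) (k : ℤ) :
    (2 : ℝ) ^ ((1 : ℝ) / 4) * (Cb * (2 : ℝ) ^ ((3 : ℝ) / 4 * (-(((1 : ℤ) + k : ℤ) : ℝ)))) *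
        (2 : ℝ) ^ θ ≤ Cb * (2 : ℝ) ^ ((3 : ℝ) / 4 * (-(k : ℝ))) := by
  have e1 : (2 : ℝ) ^ ((1 : ℝ) / 4) * (Cb * (2 : ℝ) ^ ((3 : ℝ) / 4 * (-(((1 : ℤ) + k : ℤ) : ℝ)))) *
      (2 : ℝ) ^ θ = Cb * (2 : ℝ) ^ (θ - 1 / 2 + (3 : ℝ) / 4 * (-(k : ℝ))) := by
    have : θ - 1 / 2 + (3 : ℝ) / 4 * (-(k : ℝ)) =
        (1 : ℝ) / 4 + (3 : ℝ) / 4 * (-(((1 : ℤ) + k : ℤ) : ℝ)) + θ := by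
      push_cast
      ring
    rw [this, Real.rpow_add two_pos, Real.rpow_add two_pos]
    ring
  rw [e1]
  exact mul_le_mul_of_nonneg_left (Real.rpow_le_rpow_of_exponent_le one_le_two (by linarith)) hCb

/-- Ahead-tail bookkeeping of the step: for `θ ≤ 1/2`,
`5 · (Cg · 2^{-7(1+k)}) · 2^{2θ} ≤ Cg · 2^{-7k}` (`Cg ≥ 0`). [folklore] -/
theorem ahead_shift_le {θ Cg : ℝ} (hθ : θ ≤ 1 / 2) (hCg : 0 ≤ Cg) (k : ℤ) :
    5 * (Cg * (2 : ℝ) ^ (-(7 : ℝ) * (((1 : ℤ) + k : ℤ) : ℝ))) * (2 : ℝ) ^ (2 * θ) ≤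
      Cg * (2 : ℝ) ^ (-(7 : ℝ) * (k : ℝ)) := by
  have h8 : (2 : ℝ) ^ (3 : ℝ) = 8 := by
    rw [show (3 : ℝ) = ((3 : ℕ) : ℝ) by norm_num, Real.rpow_natCast]
    norm_num
  have hX : 0 ≤ Cg * (2 : ℝ) ^ (-(7 : ℝ) * (((1 : ℤ) + k : ℤ) : ℝ)) * (2 : ℝ) ^ (2 * θ) :=
    mul_nonneg (mul_nonneg hCg (Real.rpow_nonneg zero_le_two _)) (Real.rpow_nonneg zero_le_two _)
  have e1 : (2 : ℝ) ^ (3 : ℝ) * (Cg * (2 : ℝ) ^ (-(7 : ℝ) * (((1 : ℤ) + k : ℤ) : ℝ))) *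
      (2 : ℝ) ^ (2 * θ) = Cg * (2 : ℝ) ^ (2 * θ - 4 + -(7 : ℝ) * (k : ℝ)) := by
    have : 2 * θ - 4 + -(7 : ℝ) * (k : ℝ) =
        (3 : ℝ) + -(7 : ℝ) * (((1 : ℤ) + k : ℤ) : ℝ) + 2 * θ := by
      push_cast
      ring
    rw [this, Real.rpow_add two_pos, Real.rpow_add two_pos]
    ring
  calc 5 * (Cg * (2 : ℝ) ^ (-(7 : ℝ) * (((1 : ℤ) + k : ℤ) : ℝ))) * (2 : ℝ) ^ (2 * θ)
      = 5 * (Cg * (2 : ℝ) ^ (-(7 : ℝ) * (((1 : ℤ) + k : ℤ) : ℝ)) * (2 : ℝ) ^ (2 * θ)) := by ring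
    _ ≤ (2 : ℝ) ^ (3 : ℝ) *
          (Cg * (2 : ℝ) ^ (-(7 : ℝ) * (((1 : ℤ) + k : ℤ) : ℝ)) * (2 : ℝ) ^ (2 * θ)) := by
        rw [h8]
        exact mul_le_mul_of_nonneg_right (by norm_num) hX
    _ = Cg * (2 : ℝ) ^ (2 * θ - 4 + -(7 : ℝ) * (k : ℝ)) := by rw [← e1]; ring
    _ ≤ Cg * (2 : ℝ) ^ (-(7 : ℝ) * (k : ℝ)) :=
        mul_le_mul_of_nonneg_left (Real.rpow_le_rpow_of_exponent_le one_le_two (by linarith)) hCg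

end TrappingBootstrap

open TrappingBootstrap in
/-- **Item stmt-NavierStokesRegularity-21749 (`TrappingWindowRungThree.TrappingBootstrap`, support
S1).** The window certificate K1 and the tail envelopes K2 give `ε₀ = 1`, the certificate's
`R, θ, c`, the margin `η = min η₀ η₂`, the certificate's table `α`, datum `X₀` and observable mode
`i₀`, the description `P` = «window state in some box `B_j`, behind amplitudes under
`Cb·2^{(3/4)|k|}`, ahead energies under `Cg·2^{-7k}`» (containing the datum) and the piecewise epoch
envelope `env` of K1/K2, with `RobustStep 1 θ c η i₀ α P env` — by the first-exit (real-induction)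
argument over the finitely many window coordinates described in the module docstring. MODEL
lattice statement; nothing about Navier–Stokes is concluded.
[cite: Tao2016AveragedNS, §6.4 Prop. 6.5 (statement shape of the robust step); route
TrappingWindowRungThree, item S1] -/
theorem trappingWindowRungThree_trappingBootstrap_proof :
    Summit.NavierStokesRegularity.NavierStokesRegularity.Theses.TrappingWindowRungThree.TrappingBootstrap := by
  unfold Summit.NavierStokesRegularity.NavierStokesRegularity.Theses.TrappingWindowRungThree.TrappingBootstrap
  intro hK1 hK2
  unfold Summit.NavierStokesRegularity.NavierStokesRegularity.Theses.TrappingWindowRungThree.WindowCertificate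
    at hK1
  unfold Summit.NavierStokesRegularity.NavierStokesRegularity.Theses.TrappingWindowRungThree.TailEnvelopes
    at hK2
  obtain ⟨R, θ, c, η₀, Cb, Cg, Kb, Ka, i₀, α, X₀, N₀, ℓ, ctr, rad, M, W, hR, hα, hX₀, hθ0, hθ, hc, hη₀,
    hη₀1, hCb, hCg, hKb, hKa, hdat, hbox, hW, hPC1, hPC2, hPC3, hWC, hdich⟩ := hK1
  -- the sup bounds are positive on the window (the datum box sits strictly inside them)
  have hMpos : ∀ k, -Kb ≤ k → k ≤ Ka → 0 < M k := fun k h1 h2 =>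
    (abs_nonneg _).trans_lt (hbox 0 (Nat.zero_le _) _ hdat i₀ k h1 h2)
  have hMW : ∀ k, -Kb ≤ k → k ≤ Ka → 0 < M k ∧ 0 ≤ W k := fun k h1 h2 =>
    ⟨hMpos k h1 h2, hW k h1 h2⟩
  -- the tail lemma K2 for the certificate's data
  obtain ⟨η₂, hη₂, hK2'⟩ :=
    hK2 R θ c Cb Cg Kb Ka M W α hR hα hθ0 hθ.le hc hCb hCg hKb hKa hMW hPC1 hPC2 hPC3 hWC
  -- the margin
  have hηpos : 0 < min η₀ η₂ := lt_min hη₀ hη₂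
  have hηle0 : min η₀ η₂ ≤ η₀ := min_le_left _ _
  have hηle2 : min η₀ η₂ ≤ η₂ := min_le_right _ _
  have hηle1 : min η₀ η₂ ≤ 1 := hηle0.trans hη₀1
  refine ⟨1, R, θ, c, min η₀ η₂, i₀, α, X₀,
    (fun S₀ F₀ => (∃ j : ℕ, j ≤ N₀ ∧ ∀ l, |ℓ j l S₀ - ctr j l| ≤ rad j l) ∧
      (∀ i k, k < -Kb → |S₀ i k| ≤ Cb * (2 : ℝ) ^ ((3 : ℝ) / 4 * (-(k : ℝ)))) ∧
      (∀ i k, Ka < k → F₀ i k ≤ Cg * (2 : ℝ) ^ (-(7 : ℝ) * (k : ℝ)))),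
    (fun j : ℤ => if j < -Kb then 2 * (Cb * (2 : ℝ) ^ ((3 : ℝ) / 4 * (-(j : ℝ)))) ^ 2
      else if Ka < j then 5 * (Cg * (2 : ℝ) ^ (-(7 : ℝ) * (j : ℝ))) else (1 / 2) * M j ^ 2 + W j),
    rfl, hR, hθ0, hθ.le, hc, hηpos, hα, hX₀, ?_, ?_⟩
  · -- the datum is described by `P`
    refine ⟨⟨0, Nat.zero_le _, hdat⟩, fun i k hk => ?_, fun i k hk => ?_⟩
    · have hk0 : k ≠ 0 := by omega
      rw [datumState_of_ne i₀ X₀ i hk0, abs_zero]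
      positivity
    · have hk0 : k ≠ 0 := by omega
      rw [datumEnergy_apply, if_neg hk0, zero_div]
      positivity
  -- the robust step
  intro L S₀ F₀ B₀ hP hB τ hcτ S F hflow
  obtain ⟨⟨j, hj, hS₀box⟩, hbehind0, hahead0⟩ := hP
  by_contra hno
  have hScont : ∀ i k, ContinuousOn (S i k) (Icc 0 τ) := fun i k =>
    (hflow.contDiffOn_S i k).continuousOn
  have hinit : (fun i k => S i k 0) = S₀ := funext fun i => funext fun k => hflow.init_S i k
  -- KEY: under "no step", weak window bounds on `[0, σ]` are strict and `σ < c`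
  have key : ∀ σ, 0 < σ → σ ≤ c →
      (∀ i k, -Kb ≤ k → k ≤ Ka → ∀ u ∈ Icc 0 σ, |S i k u| ≤ M k) →
      (∀ i k, -Kb ≤ k → k ≤ Ka → ∀ u ∈ Icc 0 σ, |S i k u| < M k) ∧ σ < c := by
    intro σ hσ hσc hwk
    have hστ : σ ≤ τ := hσc.trans hcτ
    obtain ⟨hC1, hC2, hC3, hC4, hC5⟩ := hK2' (min η₀ η₂) σ τ L S₀ F₀ B₀ S F hηpos hηle2 hflow
      hbehind0 hahead0 hB hσ hστ hσc hwk
    have hmotion : ∀ i k, -Kb ≤ k → k ≤ Ka → ∀ s ∈ Icc 0 σ,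
        |derivWithin (S i k) (Icc 0 τ) s - quadTerm 1 α S i k s| ≤
          min η₀ η₂ * (2 : ℝ) ^ ((2 : ℝ) * (k : ℝ)) * Real.sqrt (F i k s) := by
      intro i k _ _ u hu
      have hm := hflow.motion i k u ⟨hu.1, hu.2.trans hστ⟩
      rw [one_add_one_eq_two] at hm
      exact hm
    have hsand : ∀ i k, -Kb ≤ k → k ≤ Ka → ∀ s ∈ Icc 0 σ,
        (1 / 2) * S i k s ^ 2 ≤ F i k s ∧ F i k s ≤ (1 / 2) * S i k s ^ 2 + min η₀ η₂ * W k :=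
      fun i k h1 h2 u hu => ⟨hflow.defect_lower i k u ⟨hu.1, hu.2.trans hστ⟩, (hC3 i k h1 h2 u hu).le⟩
    rcases hdich j (min η₀ η₂) σ τ S F hj hηpos.le hηle0 hσ hστ
        (fun i k _ _ => hflow.contDiffOn_S i k) (by rw [hinit]; exact hS₀box)
        (fun i u hu => (hC1 i u hu).le) (fun i u hu => (hC2 i u hu).le) hmotion hsand with
      hstep | hinside
    · exfalso
      obtain ⟨j', τ₁, a, hj', hτ₁, hτ₁σ, hτ₁c, ha, h2a, haS, hbox', hbot, hwin⟩ := hstep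
      have hτ₁I : τ₁ ∈ Icc 0 σ := ⟨hτ₁.le, hτ₁σ⟩
      apply hno
      refine ⟨τ₁, a, ?_⟩
      dsimp only [StepTo, epochEnvelope]
      refine ⟨hτ₁, hτ₁c, ha, ?_, haS, ⟨⟨j', hj', hbox'⟩, ?_, ?_⟩, ?_⟩
      · rw [one_add_one_eq_two]
        exact h2a
      · -- behind tail of the shifted, rescaled state
        intro i k hk
        rw [abs_div, abs_of_pos ha]
        rcases lt_or_eq_of_le (show (1 : ℤ) + k ≤ -Kb by omega) with hlt | heq
        · have hS := (hC4 i (1 + k) hlt τ₁ hτ₁I).1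
          calc |S i (1 + k) τ₁| / a ≤ |S i (1 + k) τ₁| * (2 : ℝ) ^ θ :=
                div_le_mul_two_rpow ha h2a (abs_nonneg _)
            _ ≤ (2 : ℝ) ^ ((1 : ℝ) / 4) * (Cb * (2 : ℝ) ^ ((3 : ℝ) / 4 * (-(((1 : ℤ) + k : ℤ) : ℝ))))
                  * (2 : ℝ) ^ θ :=
                mul_le_mul_of_nonneg_right hS (Real.rpow_nonneg zero_le_two θ)
            _ ≤ Cb * (2 : ℝ) ^ ((3 : ℝ) / 4 * (-(k : ℝ))) := behind_shift_le hθ.le hCb.le k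
        · rw [heq]
          have hcast : (-(k : ℝ)) = (Kb : ℝ) + 1 := by
            have h' : (((1 : ℤ) + k : ℤ) : ℝ) = ((-Kb : ℤ) : ℝ) := by rw [heq]
            push_cast at h'
            linarith
          rw [hcast]
          exact hbot i
      · -- ahead tail of the shifted, rescaled state
        intro i k hk
        have h1k : Ka < 1 + k := by omega
        have hF := hC5 i (1 + k) h1k τ₁ hτ₁I
        have hFnn : 0 ≤ F i (1 + k) τ₁ := hflow.nonneg_F i (1 + k) τ₁ ⟨hτ₁.le, hτ₁σ.trans hστ⟩
        calc F i (1 + k) τ₁ / a ^ 2 ≤ F i (1 + k) τ₁ * (2 : ℝ) ^ (2 * θ) :=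
              div_sq_le_mul_two_rpow ha h2a hFnn
          _ ≤ 5 * (Cg * (2 : ℝ) ^ (-(7 : ℝ) * (((1 : ℤ) + k : ℤ) : ℝ))) * (2 : ℝ) ^ (2 * θ) :=
              mul_le_mul_of_nonneg_right hF (Real.rpow_nonneg zero_le_two _)
          _ ≤ Cg * (2 : ℝ) ^ (-(7 : ℝ) * (k : ℝ)) := ahead_shift_le hθ.le hCg.le k
      · -- the epoch envelope on `[0, τ₁]`
        intro u hu i k
        have huσ : u ∈ Icc 0 σ := ⟨hu.1, hu.2.trans hτ₁σ⟩
        by_cases hk1 : k < -Kb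
        · rw [if_pos hk1]
          exact (hC4 i k hk1 u huσ).2
        · rw [if_neg hk1]
          by_cases hk2 : Ka < k
          · rw [if_pos hk2]
            exact hC5 i k hk2 u huσ
          · rw [if_neg hk2]
            push Not at hk1 hk2
            have hSM := hwin i k hk1 hk2 u hu
            have hF := hC3 i k hk1 hk2 u huσ
            have h1 : S i k u ^ 2 ≤ M k ^ 2 := by
              rw [← sq_abs (S i k u)]
              exact pow_le_pow_left₀ (abs_nonneg _) hSM 2
            have h2 : min η₀ η₂ * W k ≤ W k := mul_le_of_le_one_left (hW k hk1 hk2) hηle1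
            linarith
    · exact ⟨hinside.2, hinside.1⟩
  -- the set of times up to which the window bounds hold
  set s : Set ℝ := {σ | σ ∈ Icc (0 : ℝ) c ∧ ∀ i k, -Kb ≤ k → k ≤ Ka → |S i k σ| ≤ M k} with hs_def
  have hs_sub : s ⊆ Icc 0 c := fun σ hσ => hσ.1
  have hs_closed : IsClosed (s ∩ Icc 0 c) := by
    rw [inter_eq_left.mpr hs_sub]
    have hs_eq : s = ⋂ i : Fin 4, ⋂ k : ℤ,
        {σ | σ ∈ Icc (0 : ℝ) c ∧ (-Kb ≤ k → k ≤ Ka → |S i k σ| ≤ M k)} := by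
      ext σ
      simp only [hs_def, mem_setOf_eq, mem_iInter]
      constructor
      · rintro ⟨h1, h2⟩ i k
        exact ⟨h1, h2 i k⟩
      · intro h
        exact ⟨(h 0 0).1, fun i k => (h i k).2⟩
    rw [hs_eq]
    refine isClosed_iInter fun i => isClosed_iInter fun k => ?_
    by_cases hk : -Kb ≤ k ∧ k ≤ Ka
    · have hset : {σ | σ ∈ Icc (0 : ℝ) c ∧ (-Kb ≤ k → k ≤ Ka → |S i k σ| ≤ M k)} =
          {σ ∈ Icc (0 : ℝ) c | |S i k σ| ≤ M k} := by
        ext σ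
        simp only [mem_setOf_eq]
        exact ⟨fun h => ⟨h.1, h.2 hk.1 hk.2⟩, fun h => ⟨h.1, fun _ _ => h.2⟩⟩
      rw [hset]
      exact isClosed_Icc.isClosed_le ((hScont i k).mono (Icc_subset_Icc_right hcτ)).abs
        continuousOn_const
    · have hset : {σ | σ ∈ Icc (0 : ℝ) c ∧ (-Kb ≤ k → k ≤ Ka → |S i k σ| ≤ M k)} = Icc 0 c := by
        ext σ
        simp only [mem_setOf_eq]
        exact ⟨fun h => h.1, fun h => ⟨h, fun h1 h2 => absurd ⟨h1, h2⟩ hk⟩⟩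
      rw [hset]
      exact isClosed_Icc
  have h0s : (0 : ℝ) ∈ s := by
    refine ⟨⟨le_rfl, hc.le⟩, fun i k h1 h2 => ?_⟩
    rw [hflow.init_S]
    exact (hbox j hj S₀ hS₀box i k h1 h2).le
  have hIcc : Icc 0 c ⊆ s := by
    refine hs_closed.Icc_subset_of_forall_mem_nhdsGT_of_Icc_subset h0s fun t ht hts => ?_
    -- strict window bounds at time `t`
    have hstrict : ∀ i k, -Kb ≤ k → k ≤ Ka → |S i k t| < M k := by
      rcases ht.1.eq_or_lt with h0 | htpos
      · rw [← h0]
        intro i k h1 h2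
        rw [hflow.init_S]
        exact hbox j hj S₀ hS₀box i k h1 h2
      · have hweak : ∀ i k, -Kb ≤ k → k ≤ Ka → ∀ u ∈ Icc 0 t, |S i k u| ≤ M k :=
          fun i k h1 h2 u hu => (hts hu).2 i k h1 h2
        exact fun i k h1 h2 => (key t htpos ht.2.le hweak).1 i k h1 h2 t ⟨ht.1, le_rfl⟩
    -- by continuity they persist on a right neighbourhood of `t`
    have htτ : t < τ := ht.2.trans_le hcτ
    have hle : 𝓝[>] t ≤ 𝓝[Icc 0 τ] t := by
      rw [← nhdsWithin_Ioo_eq_nhdsGT htτ]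
      exact nhdsWithin_mono _ fun x hx => ⟨ht.1.trans hx.1.le, hx.2.le⟩
    have hev : ∀ᶠ σ in 𝓝[>] t, ∀ i : Fin 4, ∀ k ∈ Finset.Icc (-Kb) Ka, |S i k σ| < M k := by
      refine eventually_all.mpr fun i => (eventually_all_finset _).mpr fun k hk => ?_
      rw [Finset.mem_Icc] at hk
      have hcont : ContinuousWithinAt (S i k) (Icc 0 τ) t :=
        (hScont i k).continuousWithinAt ⟨ht.1, htτ.le⟩
      exact ((hcont.tendsto.abs).eventually (gt_mem_nhds (hstrict i k hk.1 hk.2))).filter_mono hle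
    filter_upwards [hev, Icc_mem_nhdsGT ht.2] with σ hσ hσ'
    exact ⟨⟨ht.1.trans hσ'.1, hσ'.2⟩, fun i k h1 h2 => (hσ i k (Finset.mem_Icc.mpr ⟨h1, h2⟩)).le⟩
  have hweak : ∀ i k, -Kb ≤ k → k ≤ Ka → ∀ u ∈ Icc 0 c, |S i k u| ≤ M k :=
    fun i k h1 h2 u hu => (hIcc hu).2 i k h1 h2
  exact lt_irrefl c (key c hc le_rfl hweak).2

end Summit.NavierStokesRegularity.NavierStokesRegularity.Theorems

end
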